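import Mathlib.FieldTheory.PrimitiveElement
import Mathlib.LinearAlgebra.Matrix.NonsingularInverse
import HarnessLib

/-!
# Crux `Steer` (stmt-ResolutionOfSingularities-16345), chain W4.1 — NRA bi-cone lemma, FILE 2: THE DEDEKIND DUAL
# («the columns of the embedding matrix are independent»)

OURS (campaign `res-hironaka`, rung L ★L-G4, slot W4.1; bi-cone lemma `NonRationalWindow.BiCone`, route `NRA/BiCone-PROOF-ROUTE.md` 7e57beb60ac2f3f0 §3;
seat res-D-pv-053 g9 on res-L0-w41-plan-1 RULING 286 (d)). Candidates, not facts; nothing here is a statement of H. Hironakaʼs manuscript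
[Hironaka2017] (status: under review). AI-written; AI review is weaker than expert review. Definition-free, Mathlib-only field theory.

## What is proved
For a finite separable field extension `L/k`, an algebraically closed `K/k`, and a `k`-linearly independent family `x : ι → L`:
* `linearIndependent_embeddings` — the embeddings `ψ : L →ₐ[k] K`, as `K`-valued functions on `L`, are `K`-linearly independent (Dedekind / Artin,
  Mathlib `linearIndependent_monoidHom`).
* **`embedding_dual_eq_zero`** — if `a : ι → K` satisfies `Σ_i a_i ψ(x_i) = 0` for EVERY embedding `ψ`, then `a = 0`: the square matrix
  `(ψ(b_j))_{ψ, j}` over a basis `b ⊇ x` (there are `[L : k]` embeddings, `AlgHom.card`) has independent rows by Dedekind, hence is invertible,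
  hence has independent columns.
[folklore]
-/

noncomputable section

-- `Summit.<S>.<S>.…` duplicates the summit name by design (single-problem summit).
set_option linter.dupNamespace false

open Module

namespace Summit.ResolutionOfSingularities.ResolutionOfSingularities.Theorems.SwitchingDichotomy.NonRationalWindow.BiConeDedekind

variable {k L K : Type*} [Field k] [Field L] [Algebra k L] [Field K] [Algebra k K]

/-- **Dedekind–Artin**: distinct `k`-embeddings `L → K` are `K`-linearly independent as functions. [folklore] -/
theorem linearIndependent_embeddings : LinearIndependent K (fun ψ : L →ₐ[k] K => (ψ : L → K)) :=
  (linearIndependent_monoidHom L K).comp ((↑) : (L →ₐ[k] K) → L →* K)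
    fun _ _ hfg => AlgHom.ext fun x => DFunLike.ext_iff.1 hfg x

/-- A `K`-linear combination of embeddings vanishing on a `k`-basis of `L` has all coefficients zero. [folklore] -/
theorem eq_zero_of_sum_smul_embeddings_basis {I : Type*} [Fintype I] (b : Basis I k L) {E : Type*} [Fintype E] (ψ : E → (L →ₐ[k] K))
    (hψ : Function.Injective ψ) {c : E → K} (h : ∀ j : I, ∑ r, c r * ψ r (b j) = 0) : c = 0 := by
  classical
  -- the combination, as a `k`-linear map `L → K`, vanishes on the basis `b`, hence everywhere
  let F : L →ₗ[k] K := ∑ r, c r • (ψ r).toLinearMap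
  have hF : F = 0 := b.ext fun j => by
    simp only [F, LinearMap.coe_sum, Finset.sum_apply, LinearMap.smul_apply, AlgHom.toLinearMap_apply, smul_eq_mul,
      LinearMap.zero_apply]
    exact h j
  have hfun : ∑ r, c r • ((ψ r : L →ₐ[k] K) : L → K) = 0 := by
    funext y
    have := LinearMap.congr_fun hF y
    simpa [F] using this
  -- Dedekind
  have hind := (linearIndependent_embeddings (k := k) (L := L) (K := K)).comp ψ hψ
  exact funext fun r => Fintype.linearIndependent_iff.mp hind c hfun r

variable [FiniteDimensional k L] [Algebra.IsSeparable k L] [IsAlgClosed K]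

/-- **The Dedekind dual.** For a finite separable `L/k`, an algebraically closed `K ⊇ k`, and a `k`-linearly independent family `x : ι → L`: if
`a : ι → K` satisfies `Σ_i a_i ψ(x_i) = 0` for every `k`-embedding `ψ : L → K`, then `a = 0` (rows of `(ψ(b_j))` independent by Dedekind ⇒ the
square matrix is invertible, `AlgHom.card` ⇒ columns independent). [folklore] -/
theorem embedding_dual_eq_zero {ι : Type*} [Fintype ι] {x : ι → L} (hx : LinearIndependent k x) {a : ι → K}
    (h : ∀ ψ : L →ₐ[k] K, ∑ i, a i * ψ (x i) = 0) : a = 0 := by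
  classical
  -- a basis of `L` through `x`
  have hs := hx.linearIndepOn_id
  let I : Set L := hs.extend (Set.subset_univ _)
  let b : Basis I k L := Basis.extend hs
  have hmem : ∀ i, x i ∈ I := fun i => Basis.subset_extend hs (Set.mem_range_self i)
  let φ : ι → I := fun i => ⟨x i, hmem i⟩
  have hφ : Function.Injective φ := fun i j hij => hx.injective (by simpa [φ] using congrArg Subtype.val hij)
  have hbφ : ∀ i, b (φ i) = x i := fun i => Basis.extend_apply_self hs _
  haveI : Fintype I := FiniteDimensional.fintypeBasisIndex b
  -- as many embeddings as basis vectors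
  have hcard : Fintype.card (L →ₐ[k] K) = Fintype.card I := by
    rw [AlgHom.card k L K, finrank_eq_card_basis b]
  obtain ⟨e⟩ : Nonempty ((L →ₐ[k] K) ≃ I) := Fintype.card_eq.mp hcard
  -- the square matrix `M r j = ψ_r (b j)` (rows indexed by `I` through `e`)
  let M : Matrix I I K := fun r j => e.symm r (b j)
  have hrows : LinearIndependent K M.row := by
    rw [Fintype.linearIndependent_iff]
    intro c hc r
    have hc' : ∀ j : I, ∑ r, c r * e.symm r (b j) = 0 := fun j => by
      have := congrFun hc j
      simpa [M, Matrix.row, Finset.sum_apply] using this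
    have := eq_zero_of_sum_smul_embeddings_basis b (fun r => e.symm r) e.symm.injective hc'
    exact congrFun this r
  have hunit : IsUnit M := Matrix.linearIndependent_rows_iff_isUnit.mp hrows
  have hcols : LinearIndependent K M.col := Matrix.linearIndependent_cols_iff_isUnit.mpr hunit
  -- the sub-family of columns indexed by `ι`
  have hsub : LinearIndependent K (fun i : ι => M.col (φ i)) := hcols.comp φ hφ
  have hrel : ∑ i, a i • M.col (φ i) = 0 := by
    funext r
    simp only [Finset.sum_apply, Pi.smul_apply, smul_eq_mul, Matrix.col_apply, M, hbφ, Pi.zero_apply]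
    exact h (e.symm r)
  exact funext fun i => Fintype.linearIndependent_iff.mp hsub a hrel i

end Summit.ResolutionOfSingularities.ResolutionOfSingularities.Theorems.SwitchingDichotomy.NonRationalWindow.BiConeDedekind

end
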